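import Literature.GroupTheory.CombinatorialGroupTheory.SignedHurwitzExchange
import Literature.Topology.FourManifolds.LefschetzBaseHomologyRank
import HarnessLib

/-!
# The Gram matrix of the standard symplectic pairing on the chain vectors
(wave 3, brick Z6-7 — the algebra step (R3) of the missing lemma `crossingNumber_eq_stdSymp` of
node N1a `node_M3c_shadow_pageDehnTwist` (Picard–Lefschetz on shadows) of stub
`stub_modelsOnFibred_of_reach` = NF4, line `modp-braid-orbits`, crux
`ConvexBisection.AcyclicBisectionExists`, item stmt-SmoothPoincare4-10508; registered sub-goal
`helper_stdSymp_chainVec`)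

The chain vectors `chainVec g i ∈ ℤ^{2g}` (`LefschetzBasePages.lean` §7: `v_{2j} = e_j − e_{j−1}`,
`v_{2j+1} = f_j`, the shadows of the `A_{2g}` chain of vanishing cycles) pair under the standard
symplectic form `stdSymp ℤ g` (`SignedHurwitzAction.lean`) like an `A_{2g}` chain of curves meeting
consecutively once, positively:

  **`stdSymp ℤ g (chainVec g i) (chainVec g i') = [i' = i + 1] − [i = i' + 1]`** (`i, i' < 2g`)

(`stdSymp_chainVec_chainVec`; the four parity cases `stdSymp_chainVec_even_even`, `…_odd_odd`,
`…_even_odd`, `…_odd_even`; corollaries `stdSymp_chainVec_succ = 1`, `stdSymp_chainVec_pred = −1`,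
`stdSymp_chainVec_far = 0`).  This is the algebraic half of convention (c) of
`LefschetzBasePages.lean` ("the chain is a `+1`-chain"): with it, the evaluation of the crossing
functional of a chart on a charted model chain `(b j, ψ j)` of the page
(`crossingNumber (ψ i) (b j) = [j = i+1] − [i = j+1]`, the geometric half) reads
`crossingNumber (ψ i) (b j) = stdSymp ℤ g (chainVec g i) (chainVec g j)`, which is the hypothesis
`hval` of `crossingNumber_eq_stdSymp_of_chainVec` (`…CrossingNumberShadow.lean`).

Everything is proved; no definitions, no named facts, no `sorry`.  References: V. I. Arnold,
S. M. Gusein-Zade, A. N. Varchenko, *Singularities of Differentiable Maps II* (1988), §2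
(intersection matrix of the distinguished basis of `A_μ`) [AGZV1988]; B. Farb, D. Margalit,
*A primer on mapping class groups* (2012), §6.1 [FarbMargalit2012].
-/

noncomputable section

set_option linter.dupNamespace false

open Literature.Topology.FourManifolds Literature.Topology.FourManifolds.LefschetzBase
  Literature.GroupTheory.CombinatorialGroupTheory.SignedHurwitz

namespace Summit.SmoothPoincare4.SmoothPoincare4.Theorems.AcyclicBisectionExists.ModpBraidOrbits

variable {g : ℕ}

/-! ## §1 Coordinates of the chain vectors -/

/-- Even chain vectors have no `f`-coordinates. [folklore] -/
theorem chainVec_even_inr (j k : Fin g) : chainVec g (2 * j) (Sum.inr k) = 0 := by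
  rw [chainVec_even]
  split_ifs <;> simp

/-- Odd chain vectors have no `e`-coordinates. [folklore] -/
theorem chainVec_odd_inl (j k : Fin g) : chainVec g (2 * j + 1) (Sum.inl k) = 0 := by
  rw [chainVec_odd]
  simp

/-- The `f`-coordinates of an odd chain vector. [folklore] -/
theorem chainVec_odd_inr (j k : Fin g) :
    chainVec g (2 * j + 1) (Sum.inr k) = if (k : ℕ) = j then 1 else 0 := by
  rw [chainVec_odd, Pi.single_apply]
  simp only [Sum.inr.injEq, Fin.ext_iff]

/-! ## §2 The four parity cases -/

/-- `ω(v_{2j}, v_{2j'}) = 0`. [cite: AGZV1988, §2] -/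
theorem stdSymp_chainVec_even_even (j j' : Fin g) :
    stdSymp ℤ g (chainVec g (2 * j)) (chainVec g (2 * j')) = 0 := by
  rw [chainVec_even g j]
  split_ifs
  · rw [map_sub, LinearMap.sub_apply, stdSymp_int_single_inl, stdSymp_int_single_inl,
      chainVec_even_inr, chainVec_even_inr, sub_zero]
  · rw [sub_zero, stdSymp_int_single_inl, chainVec_even_inr]

/-- `ω(v_{2j+1}, v_{2j'+1}) = 0`. [cite: AGZV1988, §2] -/
theorem stdSymp_chainVec_odd_odd (j j' : Fin g) :
    stdSymp ℤ g (chainVec g (2 * j + 1)) (chainVec g (2 * j' + 1)) = 0 := by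
  rw [chainVec_odd g j, stdSymp_int_single_inr, chainVec_odd_inl, neg_zero]

/-- `ω(v_{2j}, v_{2j'+1}) = [j = j'] − [j' + 1 = j]`. [cite: AGZV1988, §2] -/
theorem stdSymp_chainVec_even_odd (j j' : Fin g) :
    stdSymp ℤ g (chainVec g (2 * j)) (chainVec g (2 * j' + 1)) =
      (if (j : ℕ) = j' then 1 else 0) - (if (j' : ℕ) + 1 = j then 1 else 0) := by
  rw [chainVec_even g j]
  by_cases h0 : 0 < (j : ℕ)
  · rw [if_pos h0, map_sub, LinearMap.sub_apply, stdSymp_int_single_inl, stdSymp_int_single_inl,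
      chainVec_odd_inr, chainVec_odd_inr]
    congr 1
    by_cases h : (j' : ℕ) + 1 = j
    · rw [if_pos h, if_pos (by simp only; omega)]
    · rw [if_neg h, if_neg (by simp only; omega)]
  · rw [if_neg h0, sub_zero, stdSymp_int_single_inl, chainVec_odd_inr,
      if_neg (show ¬ ((j' : ℕ) + 1 = j) by omega), sub_zero]

/-- `ω(v_{2j+1}, v_{2j'}) = [j + 1 = j'] − [j' = j]`. [cite: AGZV1988, §2] -/
theorem stdSymp_chainVec_odd_even (j j' : Fin g) :
    stdSymp ℤ g (chainVec g (2 * j + 1)) (chainVec g (2 * j')) =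
      (if (j : ℕ) + 1 = j' then 1 else 0) - (if (j' : ℕ) = j then 1 else 0) := by
  rw [stdSymp_int_swap, stdSymp_chainVec_even_odd]
  ring

/-! ## §3 The Gram matrix -/

/-- **The Gram matrix of `stdSymp ℤ g` on the chain vectors is the `A_{2g}` intersection matrix**:
`ω(v_i, v_{i'}) = [i' = i + 1] − [i = i' + 1]` for `i, i' < 2g`. [cite: AGZV1988, §2] -/
theorem stdSymp_chainVec_chainVec {i i' : ℕ} (hi : i < 2 * g) (hi' : i' < 2 * g) :
    stdSymp ℤ g (chainVec g i) (chainVec g i') =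
      if i' = i + 1 then 1 else if i = i' + 1 then -1 else 0 := by
  obtain ⟨j, hj, hji⟩ : ∃ j : ℕ, j < g ∧ (i = 2 * j ∨ i = 2 * j + 1) := ⟨i / 2, by omega, by omega⟩
  obtain ⟨j', hj', hji'⟩ : ∃ j' : ℕ, j' < g ∧ (i' = 2 * j' ∨ i' = 2 * j' + 1) :=
    ⟨i' / 2, by omega, by omega⟩
  rcases hji with rfl | rfl <;> rcases hji' with rfl | rfl
  · have h := stdSymp_chainVec_even_even (⟨j, hj⟩ : Fin g) ⟨j', hj'⟩
    dsimp only at h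
    rw [h]
    split_ifs <;> omega
  · have h := stdSymp_chainVec_even_odd (⟨j, hj⟩ : Fin g) ⟨j', hj'⟩
    dsimp only at h
    rw [h]
    split_ifs <;> omega
  · have h := stdSymp_chainVec_odd_even (⟨j, hj⟩ : Fin g) ⟨j', hj'⟩
    dsimp only at h
    rw [h]
    split_ifs <;> omega
  · have h := stdSymp_chainVec_odd_odd (⟨j, hj⟩ : Fin g) ⟨j', hj'⟩
    dsimp only at h
    rw [h]
    split_ifs <;> omega

/-- **Consecutive chain vectors pair to `+1`.** [cite: AGZV1988, §2] -/
theorem stdSymp_chainVec_succ {i : ℕ} (hi : i + 1 < 2 * g) :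
    stdSymp ℤ g (chainVec g i) (chainVec g (i + 1)) = 1 := by
  rw [stdSymp_chainVec_chainVec (by omega) hi, if_pos rfl]

/-- **Consecutive chain vectors, reversed, pair to `−1`.** [cite: AGZV1988, §2] -/
theorem stdSymp_chainVec_pred {i : ℕ} (hi : i + 1 < 2 * g) :
    stdSymp ℤ g (chainVec g (i + 1)) (chainVec g i) = -1 := by
  rw [stdSymp_chainVec_chainVec hi (by omega), if_neg (by omega), if_pos rfl]

/-- **Non-adjacent chain vectors are orthogonal.** [cite: AGZV1988, §2] -/
theorem stdSymp_chainVec_far {i i' : ℕ} (hi : i < 2 * g) (hi' : i' < 2 * g) (h₁ : i' ≠ i + 1)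
    (h₂ : i ≠ i' + 1) : stdSymp ℤ g (chainVec g i) (chainVec g i') = 0 := by
  rw [stdSymp_chainVec_chainVec hi hi', if_neg h₁, if_neg h₂]

/-! ## §4 The registered form -/

/-- **Sub-goal `helper_stdSymp_chainVec`** (Z6-7, the algebra step (R3) of the missing lemma of
node N1a of NF4): the Gram matrix of the standard symplectic pairing on the chain vectors is the
intersection matrix of an `A_{2g}` chain of curves meeting consecutively once, positively:
`stdSymp ℤ g (chainVec g i) (chainVec g i') = [i' = i + 1] − [i = i' + 1]` for `i, i' < 2g`.
[cite: AGZV1988, §2] -/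
theorem helper_stdSymp_chainVec : ∀ (g i i' : ℕ), i < 2 * g → i' < 2 * g → Literature.GroupTheory.CombinatorialGroupTheory.SignedHurwitz.stdSymp ℤ g (Literature.Topology.FourManifolds.LefschetzBase.chainVec g i) (Literature.Topology.FourManifolds.LefschetzBase.chainVec g i') = (if i' = i + 1 then 1 else if i = i' + 1 then -1 else 0) :=
  fun _ _ _ hi hi' => stdSymp_chainVec_chainVec hi hi'

end Summit.SmoothPoincare4.SmoothPoincare4.Theorems.AcyclicBisectionExists.ModpBraidOrbits

end
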